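import Literature.Geometry.Symplectic.SphereOpenBookTube
import HarnessLib

/-!
# The standard open book of `S³` (3/3): the open book, planarity, the Giroux conditions,
# `PlanarContactBoundary steinStructureClosedBall`

Third of three files on the standard (disc) open book of `S³ ⊂ ℂ²`; overview in
`SphereOpenBookForm.lean`.  This file:
* `SphereOpenBook.stdOpenBook : OpenBook S³` — **the standard open book**: one binding circle
  `{z₁ = 0}` with its tube, fibration `π = z₁/‖z₁‖`, pages the open discs `{z₁ ∈ ℝ₊ c}`
  (Etnyre 2006, §2, Example: `U = {z₁ = 0}`, `π_U(z₁, z₂) = z₁/|z₁|`; Wendl 2020, Fig. 5.1);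
* `isPlanar_stdOpenBook` — planar: `z ↦ (z₂, ‖z₁‖)` injects each page continuously into `S²`;
* `isGirouxForm_stdOpenBook`, `supports_stdOpenBook` — the standard contact form
  `α = ⟪J₀ z, ·⟫|_{S³}` (`girouxForm`, file 1/3) is a Giroux form for it and for the complex
  tangencies of `∂𝔻⁴` pulled back to `S³` (`boundaryPlaneField steinStructureClosedBall.J
  (closedBallBoundaryData 3)`): `ker α = ξ` (tree `mem_contactPlane_steinStructureClosedBall_iff`),
  `α ∧ dα ≠ 0` (`= 2` on `(J₀y, Ky, J₀Ky)`), `dα > 0` on the pages (the polynomial identity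
  `‖z₁‖² · (α ∧ dα)(N, U, V) = dα(U, V) · ‖z₁‖² dθ(N)` on the constraint set, `pages_algebra`),
  `α > 0` on the binding oriented as the boundary of the pages (Etnyre 2006, §3, Example: "this open
  book supports the standard contact structure `ξ_std = ker(r₁²dθ₁ + r₂²dθ₂)`");
* `planarContactBoundary_steinStructureClosedBall` — **the contact boundary `(S³, ξ_std)` of the
  standard Stein ball `(𝔻⁴, J₀, |z|²)` is planar**: first inhabitant of `PlanarContactBoundary`.

Adapted verbatim (namespace and imports only) from the standing disprover's crux work file
`Summits/SmoothPoincare4/SmoothPoincare4/Cruxes/PlanarBisectionRigidity/Disproof.lean`, §5a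
(gen 3, v7.2, sorry-free).  References: J. B. Etnyre, *Lectures on open book decompositions and
contact structures*, Clay Math. Proc. 5 (2006), §2–§3 (arXiv:math/0409402) [Etnyre2006]; C. Wendl,
*Lectures on Contact 3-Manifolds, Holomorphic Curves and Intersection Theory* (2020), §5.1 (p. 77:
Giroux forms), Fig. 5.1, §5.2 (p. 82: planar) [Wendl2020].
-/

noncomputable section

open scoped Manifold ContDiff Topology RealInnerProductSpace
open Set Function

namespace Literature.Geometry.Symplectic

namespace SphereOpenBook

open Literature.Geometry.Kaehler Literature.Topology.FourManifolds

/-- Local notation: `ℝ⁴ = ℂ²`. -/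
local notation "E4" => EuclideanSpace ℝ (Fin 4)
/-- Local notation: `ℝ³` (the chart model of `S³`). -/
local notation "E3" => EuclideanSpace ℝ (Fin 3)
/-- Local notation: `ℝ² = ℂ`. -/
local notation "E2" => EuclideanSpace ℝ (Fin 2)
/-- Local notation: `ℝ¹` (the chart model of `S¹`). -/
local notation "E1" => EuclideanSpace ℝ (Fin 1)
/-- Local notation: the unit sphere `S³ ⊂ ℂ²`. -/
local notation "S3" => (Metric.sphere (0 : EuclideanSpace ℝ (Fin 4)) 1)
/-- Local notation: the unit circle `S¹ ⊂ ℂ`. -/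
local notation "S1" => (Metric.sphere (0 : EuclideanSpace ℝ (Fin 2)) 1)
/-- Local notation: the standard complex structure `J₀` of `ℝ⁴ = ℂ²`. -/
local notation "J₀" => stdComplexStructure
/-- Local notation: the closed unit 4-ball. -/
local notation "𝔻⁴" => (Metric.closedBall (0 : EuclideanSpace ℝ (Fin 4)) 1)

attribute [local instance] Literature.Topology.FourManifolds.fact_finrank_euclideanSpace_succ

/-- **THE STANDARD (DISC) OPEN BOOK OF `S³`**: one binding circle `{z₁ = 0}` with its tube
`(p, w) ↦ (w, p)/√(1 + ‖w‖²)`, fibration `π = z₁/‖z₁‖`, pages the open discs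
`{z₁ ∈ ℝ₊ c}` (Etnyre 2006, §2, Example "`U = {z₁ = 0}`, `π_U(z₁, z₂) = z₁/|z₁|`"; Wendl 2020,
Fig. 5.1). [cite: Etnyre2006, §2, Example: the open book (U, π_U) of S³] -/
def stdOpenBook : OpenBook S3 where
  k := 1
  k_pos := one_pos
  tube := fun _ => tube
  proj := proj
  isSmoothEmbedding_tube := fun _ => isSmoothEmbedding_tube
  isOpen_range_tube := fun _ => isOpen_range_tube
  eq_zero_of_tube_eq := fun _ _ x x' w h => tube_eq_core_imp x x' w h
  proj_tube := fun _ x _ hw => coe_proj_tube x hw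
  contMDiffOn_proj := by
    rw [tubesBinding_eq]
    exact contMDiffOn_proj
  angularDeriv_ne_zero := fun y hy => by
    rw [tubesBinding_eq] at hy
    exact angularDeriv_proj_ne_zero hy

/-- The binding of the standard open book is `{z₁ = 0}`. [folklore] -/
theorem binding_stdOpenBook : stdOpenBook.binding = {z : S3 | pr₁ (z : E4) = 0} :=
  tubesBinding_eq

/-- `y ∉ B ↔ z₁(y) ≠ 0`. [folklore] -/
theorem not_mem_binding_iff (y : S3) : y ∉ stdOpenBook.binding ↔ pr₁ (y : E4) ≠ 0 := by
  rw [binding_stdOpenBook]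
  rfl

/-! ### Planarity: each page injects continuously into `S²` -/

/-- The inner product on `ℝ³` in coordinates. [folklore] -/
theorem inner_eq_sum₃ (a b : E3) : ⟪a, b⟫ = a 0 * b 0 + a 1 * b 1 + a 2 * b 2 := by
  simp [PiLp.inner_apply, Fin.sum_univ_three, mul_comm]

/-- `‖a‖² = a₀² + a₁² + a₂²` on `ℝ³`. [folklore] -/
theorem norm_sq_eq₃ (a : E3) : ‖a‖ ^ 2 = a 0 * a 0 + a 1 * a 1 + a 2 * a 2 := by
  rw [← inner_eq_sum₃, real_inner_self_eq_norm_sq]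

/-- The page map `z ↦ (x₂, x₃, ‖z₁‖)` lands in `S²`. [folklore] -/
theorem pageMap_mem (z : S3) :
    (!₂[(z : E4) 2, (z : E4) 3, ‖pr₁ (z : E4)‖] : E3) ∈ Metric.sphere (0 : E3) 1 := by
  rw [mem_sphere_zero_iff_norm]
  have h1 := norm_sq_pr_add z
  rw [norm_sq_eq₂ (pr₂ (z : E4))] at h1
  simp only [pr₂_apply_zero, pr₂_apply_one] at h1
  have h : ‖(!₂[(z : E4) 2, (z : E4) 3, ‖pr₁ (z : E4)‖] : E3)‖ ^ 2 = 1 := by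
    rw [norm_sq_eq₃]
    have e0 : (!₂[(z : E4) 2, (z : E4) 3, ‖pr₁ (z : E4)‖] : E3) 0 = (z : E4) 2 := rfl
    have e1 : (!₂[(z : E4) 2, (z : E4) 3, ‖pr₁ (z : E4)‖] : E3) 1 = (z : E4) 3 := rfl
    have e2 : (!₂[(z : E4) 2, (z : E4) 3, ‖pr₁ (z : E4)‖] : E3) 2 = ‖pr₁ (z : E4)‖ := rfl
    rw [e0, e1, e2]
    nlinarith [h1]
  exact (pow_eq_one_iff_of_nonneg (norm_nonneg _) two_ne_zero).1 h

/-- **The page map `S³ → S²`, `z ↦ (z₂, ‖z₁‖)`** (injective on each page `{arg z₁ = c}`).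
[folklore] -/
def pageMap (z : S3) : Metric.sphere (0 : E3) 1 :=
  ⟨!₂[(z : E4) 2, (z : E4) 3, ‖pr₁ (z : E4)‖], pageMap_mem z⟩

/-- The page map is continuous. [folklore] -/
theorem continuous_pageMap : Continuous pageMap := by
  refine Continuous.subtype_mk ?_ _
  have h : Continuous fun z : S3 => (z : E4) := continuous_subtype_val
  refine (PiLp.continuous_toLp 2 _).comp ?_
  refine continuous_pi fun i => ?_
  fin_cases i
  · exact (continuous_apply 2).comp ((PiLp.continuous_ofLp 2 _).comp h)
  · exact (continuous_apply 3).comp ((PiLp.continuous_ofLp 2 _).comp h)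
  · exact continuous_norm.comp (pr₁.continuous.comp h)

/-- On a page, `z₁` is recovered from `‖z₁‖` and the page angle. [folklore] -/
theorem pr₁_eq_of_page {c : S1} {z : S3} (hz : z ∈ stdOpenBook.page c) :
    pr₁ (z : E4) = ‖pr₁ (z : E4)‖ • (c : E2) := by
  obtain ⟨hb, hc⟩ := hz
  rw [not_mem_binding_iff] at hb
  have hc' : ((proj z : S1) : E2) = (c : E2) := by rw [← hc]; rfl
  rw [proj, RotationBody.coe_sphN hb] at hc'
  rw [← hc', smul_smul, mul_inv_cancel₀ (norm_ne_zero_iff.2 hb), one_smul]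

/-- **The standard open book is planar**: `z ↦ (z₂, ‖z₁‖)` is a continuous injection of each
page into `S²`. [folklore] -/
theorem isPlanar_stdOpenBook : stdOpenBook.IsPlanar := by
  intro c
  refine ⟨fun z => pageMap z.1, continuous_pageMap.comp continuous_subtype_val, ?_⟩
  rintro ⟨z, hz⟩ ⟨z', hz'⟩ h
  have h0 := congrArg (fun q : Metric.sphere (0 : E3) 1 => (q : E3)) h
  simp only [pageMap] at h0
  have h2 : (z : E4) 2 = (z' : E4) 2 := by simpa using congrArg (fun a : E3 => a 0) h0
  have h3 : (z : E4) 3 = (z' : E4) 3 := by simpa using congrArg (fun a : E3 => a 1) h0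
  have hn : ‖pr₁ (z : E4)‖ = ‖pr₁ (z' : E4)‖ := by simpa using congrArg (fun a : E3 => a 2) h0
  have h1 : pr₁ (z : E4) = pr₁ (z' : E4) := by
    rw [pr₁_eq_of_page hz, pr₁_eq_of_page hz', hn]
  apply Subtype.ext
  apply Subtype.ext
  rw [← join_pr (z : E4), ← join_pr (z' : E4), h1]
  congr 2
  ext i
  fin_cases i
  · exact h2
  · exact h3

/-! ### The Giroux conditions -/

/-- Chain rule through the inclusion `𝔻⁴ ↪ ℝ⁴` (as in the tree's
`closedBallCoeDeriv_mfderiv_apply`, restated to keep the imports light). [folklore] -/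
theorem closedBallCoeDeriv_mfderiv_incl (y : S3) (v : E3) :
    closedBallCoeDeriv ((closedBallBoundaryData 3).incl y)
        (mfderiv (𝓡 3) (𝓡∂ 4) (closedBallBoundaryData 3).incl y v) = D y v := by
  have hf : MDifferentiableAt (𝓡 3) (𝓡∂ 4) (closedBallBoundaryData 3).incl y :=
    ((closedBallBoundaryData 3).isSmoothEmbedding.contMDiff y).mdifferentiableAt (by simp)
  have hval : MDifferentiableAt (𝓡∂ 4) 𝓘(ℝ, E4) (Subtype.val : 𝔻⁴ → E4)
      ((closedBallBoundaryData 3).incl y) :=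
    (contMDiff_coe_closedBall (n := 3) _).mdifferentiableAt (by simp)
  have h := mfderiv_comp y hval hf
  rw [mfderiv_coe_closedBall] at h
  have h2 := congrArg (fun L : E3 →L[ℝ] E4 => L v) h
  exact h2.symm.trans rfl

/-- **The complex tangencies of `∂𝔻⁴`, pulled back to `S³`, are `ker α`**:
`v ∈ ξ_y ↔ ⟪J₀ y, D_y v⟫ = 0`. [folklore] -/
theorem mem_planeField_iff (y : S3) (v : E3) :
    v ∈ boundaryPlaneField steinStructureClosedBall.J (closedBallBoundaryData 3) y ↔
      ⟪J₀ (y : E4), D y v⟫ = 0 := by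
  have hx : ‖(((closedBallBoundaryData 3).incl y : 𝔻⁴) : E4)‖ = 1 := norm_eq_of_mem_sphere y
  rw [mem_boundaryPlaneField_iff]
  have e := closedBallCoeDeriv_mfderiv_incl y v
  have key := mem_contactPlane_steinStructureClosedBall_iff (x := (closedBallBoundaryData 3).incl y) hx
    (mfderiv (𝓡 3) (𝓡∂ 4) (closedBallBoundaryData 3).incl y v)
  refine key.trans ?_
  rw [e]
  exact ⟨fun h => h.2, fun h => ⟨inner_D y v, h⟩⟩

/-- `ker α = ξ`. [folklore] -/
theorem girouxForm_eq_zero_iff (y : S3) (v : E3) :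
    girouxForm y ![v] = 0 ↔
      v ∈ boundaryPlaneField steinStructureClosedBall.J (closedBallBoundaryData 3) y := by
  rw [girouxForm_apply, mem_planeField_iff]

/-- `α_y` typed over the chart model `ℝ³` (the same term). [folklore] -/
def αE (y : S3) : E3 [⋀^Fin 1]→L[ℝ] ℝ := girouxForm y

/-- `(dα)_y` typed over the chart model `ℝ³` (the same term). [folklore] -/
def dαE (y : S3) : E3 [⋀^Fin 2]→L[ℝ] ℝ := mextDeriv girouxForm y

/-- `α_y(v) = ⟪J₀ y, D_y v⟫` (typed over `ℝ³`). [folklore] -/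
theorem αE_apply (y : S3) (v : E3) : αE y ![v] = ⟪J₀ (y : E4), D y v⟫ := girouxForm_apply y v

/-- `(dα)_y(u, v) = 2⟪J₀ D_y u, D_y v⟫` (typed over `ℝ³`). [folklore] -/
theorem dαE_apply (y : S3) (u v : E3) : dαE y ![u, v] = 2 * ⟪J₀ (D y u), D y v⟫ :=
  mextDeriv_girouxForm_apply y u v

/-- `(α ∧ dα)(u, v, w)` in terms of the ambient tangent vectors. [folklore] -/
theorem wedge_girouxForm (y : S3) (u v w : E3) :
    wedge₁₂ (girouxForm y) (mextDeriv girouxForm y) u v w =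
      ⟪J₀ (y : E4), D y u⟫ * (2 * ⟪J₀ (D y v), D y w⟫) -
        ⟪J₀ (y : E4), D y v⟫ * (2 * ⟪J₀ (D y u), D y w⟫) +
          ⟪J₀ (y : E4), D y w⟫ * (2 * ⟪J₀ (D y u), D y v⟫) := by
  show αE y ![u] * dαE y ![v, w] - αE y ![v] * dαE y ![u, w] + αE y ![w] * dαE y ![u, v] = _
  rw [αE_apply, αE_apply, αE_apply, dαE_apply, dαE_apply, dαE_apply]

/-- The second ambient test vector `K y = (-y₂, y₃, y₀, -y₁)` (a second complex structure). [folklore] -/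
def kVec (y : E4) : E4 := !₂[-(y 2), y 3, y 0, -(y 1)]

/-- The three test vectors are tangent to the sphere. [folklore] -/
theorem inner_test_vectors (y : E4) :
    ⟪y, J₀ y⟫ = 0 ∧ ⟪y, kVec y⟫ = 0 ∧ ⟪y, J₀ (kVec y)⟫ = 0 := by
  refine ⟨?_, ?_, ?_⟩ <;>
  · rw [inner_eq_sum]
    simp [kVec]
    ring

/-- **`α` is a contact form**: `(α ∧ dα)(J₀y, Ky, J₀Ky) = 2‖y‖⁴ = 2 ≠ 0`. [folklore] -/
theorem contact_girouxForm (y : S3) :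
    ∃ u v w : E3, wedge₁₂ (girouxForm y) (mextDeriv girouxForm y) u v w ≠ 0 := by
  have hy : ‖(y : E4)‖ ^ 2 = 1 := by rw [norm_eq_of_mem_sphere y, one_pow]
  rw [norm_sq_eq₄] at hy
  obtain ⟨h1, h2, h3⟩ := inner_test_vectors (y : E4)
  obtain ⟨u, hu⟩ := exists_D_eq y h1
  obtain ⟨v, hv⟩ := exists_D_eq y h2
  obtain ⟨w, hw⟩ := exists_D_eq y h3
  refine ⟨u, v, w, ?_⟩
  rw [wedge_girouxForm, hu, hv, hw]
  simp only [inner_J_eq]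
  simp only [kVec, stdComplexStructure_apply_zero, stdComplexStructure_apply_one,
    stdComplexStructure_apply_two, stdComplexStructure_apply_three]
  simp
  nlinarith [hy]

/-- **THE PAGE CONDITION, algebraic core.**  With `c(X) = y₀X₁ - y₁X₀` (`‖z₁‖² dθ`),
`A(X) = ⟪J₀ y, X⟫`, `Ω(X, Y) = 2⟪J₀ X, Y⟫`: for `U, V` tangent to the page (`⊥ y`, `c = 0`) and any
tangent `N` with `c(N) > 0`, `(A ∧ Ω)(N, U, V) > 0` forces `Ω(U, V) > 0` — because
`‖z₁‖² · (A ∧ Ω)(N, U, V) = Ω(U, V) · c(N)` on the constraint set (an explicit polynomial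
identity, checked by `linear_combination`). [folklore] -/
theorem pages_algebra (y0 y1 y2 y3 N0 N1 N2 N3 U0 U1 U2 U3 V0 V1 V2 V3 : ℝ)
    (hy : y0 * y0 + y1 * y1 + y2 * y2 + y3 * y3 = 1)
    (hU : y0 * U0 + y1 * U1 + y2 * U2 + y3 * U3 = 0)
    (hV : y0 * V0 + y1 * V1 + y2 * V2 + y3 * V3 = 0)
    (hcU : y0 * U1 - y1 * U0 = 0) (hcV : y0 * V1 - y1 * V0 = 0)
    (hr : 0 < y0 * y0 + y1 * y1) (hcN : 0 < y0 * N1 - y1 * N0)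
    (hW : 0 < (y0 * N1 - y1 * N0 + y2 * N3 - y3 * N2) * (2 * (U0 * V1 - U1 * V0 + U2 * V3 - U3 * V2)) -
      (y0 * U1 - y1 * U0 + y2 * U3 - y3 * U2) * (2 * (N0 * V1 - N1 * V0 + N2 * V3 - N3 * V2)) +
      (y0 * V1 - y1 * V0 + y2 * V3 - y3 * V2) * (2 * (N0 * U1 - N1 * U0 + N2 * U3 - N3 * U2))) :
    0 < 2 * (U0 * V1 - U1 * V0 + U2 * V3 - U3 * V2) := by
  -- `‖z₁‖² · W = 2 c(N) q(U,V)` on the constraint set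
  have key : (y0 * y0 + y1 * y1) *
      ((y0 * N1 - y1 * N0 + y2 * N3 - y3 * N2) * (2 * (U0 * V1 - U1 * V0 + U2 * V3 - U3 * V2)) -
      (y0 * U1 - y1 * U0 + y2 * U3 - y3 * U2) * (2 * (N0 * V1 - N1 * V0 + N2 * V3 - N3 * V2)) +
      (y0 * V1 - y1 * V0 + y2 * V3 - y3 * V2) * (2 * (N0 * U1 - N1 * U0 + N2 * U3 - N3 * U2))) =
      2 * (y0 * N1 - y1 * N0) * (U2 * V3 - U3 * V2) := by
    linear_combination (2 * (y0 * N1 - y1 * N0) * (U2 * V3 - U3 * V2)) * hy +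
      (2 * (y0 * N1 - y1 * N0) * (y2 * U3 - y3 * U2)) * hV -
      (2 * (y0 * N1 - y1 * N0) * (y2 * V3 - y3 * V2)) * hU +
      (2 * ((y2 * N3 - y3 * N2) * (y0 * U0 + y1 * U1) - (y2 * U3 - y3 * U2) * (y0 * N0 + y1 * N1) +
        (y0 * y0 + y1 * y1) * (N2 * U3 - N3 * U2))) * hcV +
      (2 * (-(y2 * N3 - y3 * N2) * (y0 * V0 + y1 * V1) + (y2 * V3 - y3 * V2) * (y0 * N0 + y1 * N1) -
        (y0 * y0 + y1 * y1) * (N2 * V3 - N3 * V2))) * hcU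
  -- the `z₁`-part of `Ω(U, V)` vanishes
  have hp : (y0 * y0 + y1 * y1) * (U0 * V1 - U1 * V0) = 0 := by
    linear_combination (y0 * U0 + y1 * U1) * hcV - (y0 * V0 + y1 * V1) * hcU
  have hp' : U0 * V1 - U1 * V0 = 0 := (mul_eq_zero.1 hp).resolve_left hr.ne'
  have hq : 0 < (y0 * N1 - y1 * N0) * (U2 * V3 - U3 * V2) := by nlinarith [mul_pos hr hW]
  have hq' : 0 < U2 * V3 - U3 * V2 := pos_of_mul_pos_right hq hcN.le
  nlinarith [hq', hp']

/-- **`dα > 0` on the pages.** [folklore] -/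
theorem pages_girouxForm (y : S3) (hyB : y ∉ stdOpenBook.binding) (n u v : E3)
    (hn : 0 < angularDeriv stdOpenBook.proj y n) (hu : angularDeriv stdOpenBook.proj y u = 0)
    (hv : angularDeriv stdOpenBook.proj y v = 0)
    (hW : 0 < wedge₁₂ (girouxForm y) (mextDeriv girouxForm y) n u v) :
    0 < mextDeriv girouxForm y ![u, v] := by
  rw [not_mem_binding_iff] at hyB
  have hr : 0 < ‖pr₁ (y : E4)‖ ^ 2 := by positivity
  change 0 < angularDeriv proj y n at hn
  change angularDeriv proj y u = 0 at hu
  change angularDeriv proj y v = 0 at hv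
  rw [angularDeriv_proj hyB] at hn hu hv
  have hcN : 0 < (y : E4) 0 * D y n 1 - (y : E4) 1 * D y n 0 :=
    (mul_pos_iff_of_pos_left (inv_pos.2 hr)).1 hn
  have hcU : (y : E4) 0 * D y u 1 - (y : E4) 1 * D y u 0 = 0 :=
    (mul_eq_zero.1 hu).resolve_left (inv_pos.2 hr).ne'
  have hcV : (y : E4) 0 * D y v 1 - (y : E4) 1 * D y v 0 = 0 :=
    (mul_eq_zero.1 hv).resolve_left (inv_pos.2 hr).ne'
  rw [wedge_girouxForm] at hW
  show 0 < dαE y ![u, v]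
  rw [dαE_apply]
  simp only [inner_J_eq] at hW ⊢
  have hy : ‖(y : E4)‖ ^ 2 = 1 := by rw [norm_eq_of_mem_sphere y, one_pow]
  rw [norm_sq_eq₄] at hy
  have hU := inner_D y u
  have hV := inner_D y v
  rw [inner_eq_sum] at hU hV
  rw [norm_sq_eq₂] at hr
  simp only [pr₁_apply_zero, pr₁_apply_one] at hr
  exact pages_algebra _ _ _ _ _ _ _ _ _ _ _ _ _ _ _ _ hy hU hV hcU hcV hr hcN hW

/-- The binding circle: `‖x‖² = 1` and `t ⊥ x`, `t ≠ 0` give `(x₀t₁ - x₁t₀)² = ‖t‖² > 0`. [folklore] -/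
theorem cross_sq_pos {x0 x1 t0 t1 : ℝ} (hx : x0 * x0 + x1 * x1 = 1) (ht : x0 * t0 + x1 * t1 = 0)
    (hpos : 0 < t0 * t0 + t1 * t1) : 0 < (x0 * t1 - x1 * t0) ^ 2 := by
  have h : (x0 * t1 - x1 * t0) ^ 2 = t0 * t0 + t1 * t1 := by
    linear_combination (t0 * t0 + t1 * t1) * hx - (x0 * t0 + x1 * t1) * ht
  rw [h]
  exact hpos

/-- **`α > 0` on the binding oriented as the boundary of the pages.** [folklore] -/
theorem binding_girouxForm (i : Fin stdOpenBook.k) (x : S1) :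
    0 < girouxForm (tube (x, 0)) ![stdOpenBook.coreTangent i x] *
      wedge₁₂ (girouxForm (tube (x, 0))) (mextDeriv girouxForm (tube (x, 0)))
        (stdOpenBook.coreTangent i x) (stdOpenBook.discFrame i x 0) (stdOpenBook.discFrame i x 1) := by
  set t : E2 := D₁ x (EuclideanSpace.single (0 : Fin 1) (1 : ℝ)) with ht_def
  have hB : D (tube (x, 0)) (stdOpenBook.coreTangent i x) = join (0, t) :=
    D_mfderiv_tube_horizontal x _
  have hE0 : D (tube (x, 0)) (stdOpenBook.discFrame i x 0) = join (EuclideanSpace.single 0 1, 0) :=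
    D_mfderiv_tube_vertical x _
  have hE1 : D (tube (x, 0)) (stdOpenBook.discFrame i x 1) = join (EuclideanSpace.single 1 1, 0) :=
    D_mfderiv_tube_vertical x _
  rw [wedge_girouxForm]
  show 0 < αE (tube (x, 0)) ![stdOpenBook.coreTangent i x] * _
  rw [αE_apply, hB, hE0, hE1, coe_tube_zero]
  -- everything in coordinates
  simp only [inner_J_eq]
  simp only [join_apply_zero, join_apply_one, join_apply_two, join_apply_three]
  have s00 : (EuclideanSpace.single (0 : Fin 2) (1 : ℝ)) 0 = 1 := by simp
  have s01 : (EuclideanSpace.single (0 : Fin 2) (1 : ℝ)) 1 = 0 := by simp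
  have s10 : (EuclideanSpace.single (1 : Fin 2) (1 : ℝ)) 0 = 0 := by simp
  have s11 : (EuclideanSpace.single (1 : Fin 2) (1 : ℝ)) 1 = 1 := by simp
  simp only [s00, s01, s10, s11, PiLp.zero_apply]
  -- the circle data
  have hx : (x : E2) 0 * (x : E2) 0 + (x : E2) 1 * (x : E2) 1 = 1 := by
    rw [← norm_sq_eq₂, norm_eq_of_mem_sphere x, one_pow]
  have hxt : (x : E2) 0 * t 0 + (x : E2) 1 * t 1 = 0 := by
    rw [← inner_fin_two]
    exact inner_D₁ x _
  have ht0 : t ≠ 0 := by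
    intro h
    have h' : EuclideanSpace.single (0 : Fin 1) (1 : ℝ) = 0 :=
      D₁_injective x (by rw [← ht_def, h, map_zero])
    have := congrArg (fun w : E1 => w 0) h'
    simp at this
  have htpos : 0 < t 0 * t 0 + t 1 * t 1 := by
    rw [← norm_sq_eq₂]
    positivity
  have hc := cross_sq_pos hx hxt htpos
  nlinarith [hc]

/-- **`α` is a Giroux form for the standard open book and the complex tangencies of `∂𝔻⁴`.**
[folklore] -/
theorem isGirouxForm_stdOpenBook :
    stdOpenBook.IsGirouxForm
      (boundaryPlaneField steinStructureClosedBall.J (closedBallBoundaryData 3)) girouxForm where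
  smooth := isSmoothForm_girouxForm
  ker_eq := girouxForm_eq_zero_iff
  contact := contact_girouxForm
  pages := fun y hy n u v hn hu hv hW => pages_girouxForm y hy n u v hn hu hv hW
  binding := fun i x => binding_girouxForm i x

/-- The standard open book supports the complex tangencies of `∂𝔻⁴ = S³`. [folklore] -/
theorem supports_stdOpenBook :
    stdOpenBook.Supports (boundaryPlaneField steinStructureClosedBall.J (closedBallBoundaryData 3)) :=
  ⟨girouxForm, isGirouxForm_stdOpenBook⟩

end SphereOpenBook

/-- **The contact boundary `(S³, ξ_std)` of the standard Stein ball `(𝔻⁴, J₀, |z|²)` is PLANAR**: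
the disc open book `B = {z₁ = 0}`, `π = z₁/‖z₁‖` of `S³ = ∂𝔻⁴` supports the complex tangencies of
`steinStructureClosedBall`, with the Giroux form `α = ⟪J₀ z, ·⟫|_{S³}` (Etnyre 2006, §3, Example:
the open book `(U, π_U)` supports `ξ_std = ker(r₁²dθ₁ + r₂²dθ₂)`; Wendl 2020, Fig. 5.1); first
inhabitant of the tree's `OpenBook`/`Supports`/`IsPlanar`/`PlanarContactBoundary` interface.
[cite: Etnyre2006, §3, Example (U, π_U) supports ξ_std; §2, Example U = {z₁ = 0}] -/
theorem planarContactBoundary_steinStructureClosedBall :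
    PlanarContactBoundary steinStructureClosedBall :=
  ⟨Literature.Topology.FourManifolds.closedBallBoundaryData 3, SphereOpenBook.stdOpenBook,
    SphereOpenBook.isPlanar_stdOpenBook,
    SphereOpenBook.supports_stdOpenBook⟩

end Literature.Geometry.Symplectic
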